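import Literature.AnabelianGeometry.SemiGraphs.PSCCompactification
import Literature.AnabelianGeometry.Anabelioids.ProSigma
import HarnessLib

/-!
# The image datum of a PSC datum along a quotient `Π_G ↠ Q` — "we may assume `Σ = {l}`" ([CombGC] Thm. 1.6 (i))

Mochizuki, *A combinatorial version of the Grothendieck conjecture*, Tohoku Math. J. **59** (2007),
Def. 1.1 (i) p. 6 (a semi-graph of anabelioids of pro-`Σ` PSC-type is "the pro-`Σ` completion" of the
dual semi-graph with compact structure of a pointed stable curve; hence for `∅ ≠ Σ' ⊆ Σ` its pro-`Σ'`
completion — verticial / edge-like subgroups the images in the maximal pro-`Σ'` quotient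
`Π_G ↠ Π_G^{Σ'}` — is of pro-`Σ'` PSC-type) and the proof of Thm. 1.6 (i), author's ms p. 13
l.−8…−4: "since … it suffices to … we may assume that `Σ = {l}`" [cite: MochizukiCombGC2007, Thm 1.6(i) p.13].
Row T16-L04 (a) of the abc-iut [CombGC] Thm 1.6 sub-DAG (L3-lead α21-6; writer w4-d052 RULINGS v5 (5)).

Over the interface `PSCDatum Π` this file DEFINES, for a continuous surjection `f : Π_G ↠ Q` onto a
Hausdorff group (`Π_G` compact) and a nonempty `S ⊆ Σ` with `Q` pro-`S`, the IMAGE DATUM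
`G.mapAlong f hf S hS hne hQ : PSCDatum Q`: SAME underlying semi-graph and genera, verticial /
nodal / cuspidal subgroups the images `f(Π_v)`, `f(Π_e)`, `f(Π_c)` — `compactifyAlong`
(`PSCCompactification.lean`) WITHOUT deleting the cusps, with `Σ` replaced by `S`.  Intended
instance: `f` a presentation of the maximal pro-`l` quotient, `S = {l}` (`IsMaxProSigmaQuotient`).
The origin-level statement `MapAlongProLOfPSCTypeHolds Ω` ("the pro-`S` completion of a PSC-type
datum is of pro-`S` PSC-type") is a Prop-valued def, hypothesis-only (FACT policy).  Also proved:
defining equations, `isVerticial/isNodal/isCuspidal/isEdgeLike_mapAlong_iff` (the Def. 1.1 (ii)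
classes of the image datum are the images of those of `G`), and the count transfers
`mapAlong_cuspCount/nodeCount/vertCount` along `f` for coverings `H ⊇ ker f` (formal input of
T16-L04 (b)).  Nothing here asserts anything about pointed stable curves; no statement takes a
side on [IUTchIII] Cor. 3.12.
-/

namespace Literature.AnabelianGeometry.SemiGraphs

open scoped Pointwise

universe u

namespace PSCDatum

variable {P : Type u} [Group P] [TopologicalSpace P] (G : PSCDatum P)
variable {Q : Type u} [Group Q] [TopologicalSpace Q]

/-! ### Presentations of the maximal pro-`S` quotient -/

/-- `f : Π ↠ Q` PRESENTS THE MAXIMAL PRO-`S` QUOTIENT of `Π`: `f` is a continuous surjection onto a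
pro-`S` group whose kernel lies in every open normal subgroup of `Π` of `S`-integer index (so that
every finite `S`-quotient of `Π` factors through `f`).  For `S = {l}`: the maximal pro-`l` quotient
`Π_G ↠ Π_G^{(l)}` of [CombGC] Thm. 1.6 (i) p. 13. [cite: MochizukiCombGC2007, Thm 1.6(i) p.13] -/
@[mk_iff] structure IsMaxProSigmaQuotient (S : Set ℕ) (f : P →* Q) : Prop where
  continuous : Continuous f
  surjective : Function.Surjective f
  proSigma : IsProSigma S Q
  ker_le : ∀ N : Subgroup P, N.Normal → IsOpen (N : Set P) →
    Anabelioids.IsSigmaInteger S N.index → f.ker ≤ N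

/-! ### The image datum along `f` -/

section Along

variable [CompactSpace P] [T2Space Q] (f : P →* Q) (hf : Continuous f)
  (S : Set ℕ) (hS : S ⊆ G.Sigma) (hne : S.Nonempty) (hQ : IsProSigma S Q)

/-- **The image of the PSC datum `G` along `f : Π_G ↠ Q`, as a pro-`S` datum** (`∅ ≠ S ⊆ Σ`, `Q`
pro-`S`): same underlying semi-graph and genera; verticial, nodal and cuspidal subgroups the images
`f(Π_v)`, `f(Π_e)`, `f(Π_c)` (closed: `Π_G` compact, `Q` Hausdorff); branch inclusions pushed
forward.  For `f` the maximal pro-`l` quotient and `S = {l}` this is the datum "`G` with `Σ = {l}`" of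
the proof of Thm. 1.6 (i) ("we may assume that `Σ = {l}`"). [cite: MochizukiCombGC2007, Thm 1.6(i) p.13] -/
noncomputable def mapAlong : PSCDatum Q where
  Sigma := S
  sigma_prime p hp := G.sigma_prime p (hS hp)
  sigma_nonempty := hne
  graph := G.graph
  vertGp v := (G.vertGp v).map f
  nodeGp e := (G.nodeGp e).map f
  cuspGp c := (G.cuspGp c).map f
  genus := G.genus
  isClosed_vertGp v := ((G.isClosed_vertGp v).isCompact.image hf).isClosed
  isClosed_nodeGp e := ((G.isClosed_nodeGp e).isCompact.image hf).isClosed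
  isClosed_cuspGp c := ((G.isClosed_cuspGp c).isCompact.image hf).isClosed
  nodeGp_le e := by
    obtain ⟨v₁, v₂, he, ⟨γ₁, h₁⟩, ⟨γ₂, h₂⟩⟩ := G.nodeGp_le e
    exact ⟨v₁, v₂, he, ⟨_, (map_conj_smul f γ₁ _).symm.trans_le (Subgroup.map_mono h₁)⟩,
      ⟨_, (map_conj_smul f γ₂ _).symm.trans_le (Subgroup.map_mono h₂)⟩⟩
  cuspGp_le c := by
    obtain ⟨γ, h⟩ := G.cuspGp_le c
    exact ⟨_, (map_conj_smul f γ _).symm.trans_le (Subgroup.map_mono h)⟩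
  proSigma := hQ

/-- `Σ` of the image datum is `S`. [cite: MochizukiCombGC2007, Thm 1.6(i) p.13] -/
@[simp] theorem mapAlong_Sigma : (G.mapAlong f hf S hS hne hQ).Sigma = S := rfl

/-- The underlying semi-graph is unchanged. [cite: MochizukiCombGC2007, Thm 1.6(i) p.13] -/
@[simp] theorem mapAlong_graph : (G.mapAlong f hf S hS hne hQ).graph = G.graph := rfl

/-- `Π_v ↦ f(Π_v)`. [cite: MochizukiCombGC2007, Thm 1.6(i) p.13] -/
@[simp] theorem mapAlong_vertGp (v : G.graph.V) :
    (G.mapAlong f hf S hS hne hQ).vertGp v = (G.vertGp v).map f := rfl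

/-- `Π_e ↦ f(Π_e)`. [cite: MochizukiCombGC2007, Thm 1.6(i) p.13] -/
@[simp] theorem mapAlong_nodeGp (e : G.graph.N) :
    (G.mapAlong f hf S hS hne hQ).nodeGp e = (G.nodeGp e).map f := rfl

/-- `Π_c ↦ f(Π_c)`. [cite: MochizukiCombGC2007, Thm 1.6(i) p.13] -/
@[simp] theorem mapAlong_cuspGp (c : G.graph.C) :
    (G.mapAlong f hf S hS hne hQ).cuspGp c = (G.cuspGp c).map f := rfl

/-- Genera unchanged. [cite: MochizukiCombGC2007, Thm 1.6(i) p.13] -/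
@[simp] theorem mapAlong_genus (v : G.graph.V) : (G.mapAlong f hf S hS hne hQ).genus v = G.genus v :=
  rfl

/-- Sturdiness unchanged. [cite: MochizukiCombGC2007, Rmk 1.1.5 p.8] -/
theorem isSturdy_mapAlong_iff : (G.mapAlong f hf S hS hne hQ).IsSturdy ↔ G.IsSturdy := Iff.rfl

/-- **Verticial subgroups of the image datum** are the images of the verticial subgroups of `Π_G`.
[cite: MochizukiCombGC2007, Def 1.1(ii) p.6] -/
theorem isVerticial_mapAlong_iff (hs : Function.Surjective f) (A : Subgroup Q) :
    (G.mapAlong f hf S hS hne hQ).IsVerticial A ↔ ∃ B, G.IsVerticial B ∧ A = B.map f := by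
  constructor
  · rintro ⟨v, δ, rfl⟩
    obtain ⟨γ, hγ⟩ := exists_smul_map_eq hs δ (G.vertGp v)
    exact ⟨γ • G.vertGp v, ⟨v, γ, rfl⟩, hγ⟩
  · rintro ⟨B, ⟨v, γ, rfl⟩, rfl⟩
    exact ⟨v, _, map_conj_smul f γ _⟩

/-- **Nodal subgroups of the image datum** are the images of the nodal subgroups of `Π_G`.
[cite: MochizukiCombGC2007, Def 1.1(ii) p.7] -/
theorem isNodal_mapAlong_iff (hs : Function.Surjective f) (A : Subgroup Q) :
    (G.mapAlong f hf S hS hne hQ).IsNodal A ↔ ∃ B, G.IsNodal B ∧ A = B.map f := by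
  constructor
  · rintro ⟨e, δ, rfl⟩
    obtain ⟨γ, hγ⟩ := exists_smul_map_eq hs δ (G.nodeGp e)
    exact ⟨γ • G.nodeGp e, ⟨e, γ, rfl⟩, hγ⟩
  · rintro ⟨B, ⟨e, γ, rfl⟩, rfl⟩
    exact ⟨e, _, map_conj_smul f γ _⟩

/-- **Cuspidal subgroups of the image datum** are the images of the cuspidal subgroups of `Π_G`.
[cite: MochizukiCombGC2007, Def 1.1(ii) p.7] -/
theorem isCuspidal_mapAlong_iff (hs : Function.Surjective f) (A : Subgroup Q) :
    (G.mapAlong f hf S hS hne hQ).IsCuspidal A ↔ ∃ B, G.IsCuspidal B ∧ A = B.map f := by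
  constructor
  · rintro ⟨c, δ, rfl⟩
    obtain ⟨γ, hγ⟩ := exists_smul_map_eq hs δ (G.cuspGp c)
    exact ⟨γ • G.cuspGp c, ⟨c, γ, rfl⟩, hγ⟩
  · rintro ⟨B, ⟨c, γ, rfl⟩, rfl⟩
    exact ⟨c, _, map_conj_smul f γ _⟩

/-- **Edge-like subgroups of the image datum** are the images of the edge-like subgroups of `Π_G`.
[cite: MochizukiCombGC2007, Def 1.1(ii) pp.6-7] -/
theorem isEdgeLike_mapAlong_iff (hs : Function.Surjective f) (A : Subgroup Q) :
    (G.mapAlong f hf S hS hne hQ).IsEdgeLike A ↔ ∃ B, G.IsEdgeLike B ∧ A = B.map f := by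
  simp only [IsEdgeLike, G.isNodal_mapAlong_iff f hf S hS hne hQ hs, G.isCuspidal_mapAlong_iff f hf S hS hne hQ hs]
  constructor
  · rintro (⟨B, hB, rfl⟩ | ⟨B, hB, rfl⟩)
    · exact ⟨B, Or.inl hB, rfl⟩
    · exact ⟨B, Or.inr hB, rfl⟩
  · rintro ⟨B, hB | hB, rfl⟩
    · exact Or.inl ⟨B, hB, rfl⟩
    · exact Or.inr ⟨B, hB, rfl⟩

/-! ### Counts along `f`: the coverings of `G` containing `ker f` and those of the image datum -/

/-- **`r` along `f`**: for `ker f ⊆ H`, the covering of the image datum attached to `f(H)` has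
`r(G_H)` cusps (the cusps `H \ Π / Π_c` and `f(H) \ Q / f(Π_c)` correspond).
[cite: MochizukiCombGC2007, Def 1.4(ii) p.10] -/
theorem mapAlong_cuspCount (hs : Function.Surjective f) {H : Subgroup P} (hH : f.ker ≤ H) :
    (G.mapAlong f hf S hS hne hQ).cuspCount (H.map f) = G.cuspCount H :=
  Finset.sum_congr rfl fun c _ => card_doubleCosetQuotient_map hs hH (G.cuspGp c)

/-- **`n` along `f`** (`ker f ⊆ H`). [cite: MochizukiCombGC2007, Def 1.1(ii) p.6] -/
theorem mapAlong_nodeCount (hs : Function.Surjective f) {H : Subgroup P} (hH : f.ker ≤ H) :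
    (G.mapAlong f hf S hS hne hQ).nodeCount (H.map f) = G.nodeCount H :=
  Finset.sum_congr rfl fun e _ => card_doubleCosetQuotient_map hs hH (G.nodeGp e)

/-- **`i` along `f`** (`ker f ⊆ H`). [cite: MochizukiCombGC2007, Def 1.1(ii) p.6] -/
theorem mapAlong_vertCount (hs : Function.Surjective f) {H : Subgroup P} (hH : f.ker ≤ H) :
    (G.mapAlong f hf S hS hne hQ).vertCount (H.map f) = G.vertCount H :=
  Finset.sum_congr rfl fun v _ => card_doubleCosetQuotient_map hs hH (G.vertGp v)

end Along

/-! ### Origin-level statement: the pro-`S` completion of a PSC-type datum is of PSC-type -/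

/-- **[CombGC] Def. 1.1 (i) / Thm. 1.6 (i) p. 13 "we may assume that `Σ = {l}`"**, over the origin
predicate: for `G` of pro-`Σ` PSC-type, `∅ ≠ S ⊆ Σ`, and every presentation `f : Π_G ↠ Q` of the
maximal pro-`S` quotient of `Π_G` (`IsMaxProSigmaQuotient S f`, `Q` Hausdorff), the image datum
`G.mapAlong f …` — the pro-`S` completion of `G` — is of (pro-`S`) PSC-type.  Hypothesis-only at the
geometric origin (FACT policy). [cite: MochizukiCombGC2007, Thm 1.6(i) p.13] -/
def MapAlongProLOfPSCTypeHolds (Ω : PSCOrigin.{u}) : Prop :=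
  ∀ ⦃P : Type u⦄ [Group P] [TopologicalSpace P] [IsTopologicalGroup P] [CompactSpace P]
    ⦃Q : Type u⦄ [Group Q] [TopologicalSpace Q] [IsTopologicalGroup Q] [T2Space Q]
    (G : PSCDatum P) (S : Set ℕ) (hS : S ⊆ G.Sigma) (hne : S.Nonempty) (f : P →* Q)
    (h : IsMaxProSigmaQuotient S f),
    Ω.IsOfPSCType G → Ω.IsOfPSCType (G.mapAlong f h.continuous S hS hne h.proSigma)

end PSCDatum

end Literature.AnabelianGeometry.SemiGraphs
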